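import Summits.QuantumFields.YangMills.Theorems.BalabanLadderIRScalingHeredity
import HarnessLib

/-!
# LINE «scaling-heredity» — crux `BalabanLadder.IR` (stmt-QuantumFields-19354), token **E**

Ideator seat ym-ir-idea-14 (gen 2), lens «strengthen-to-induct» / «assume no gap».  HONESTY: nothing in this file proves
the Clay Yang–Mills mass gap; `R4` (`BalabanUVStability4`) closes only the conditional finite-𝕋⁴ rung `BalabanLadder.UV`;
this file re-types token **E** (`ColdExitAt (1/24)`, one 96 %-pure cold `4:1` torus per weak coupling) of the proved bill
`E → X → N → IR` (`BasinRung.IR_of_exitAt24`) as an INDUCTION ALONG THE RENORMALISATION-GROUP DIAGONAL of the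
`(β, log L)` plane, and discharges no Yang–Mills content.

* `ScalingHereditySC` (**OH**, the LOAD, new): one ultra-pure COARSE coupling `β` (defect `≤ 2⁻²⁵` at every scale `≥ L`)
  forces every FINER coupling one bracket up, `β' ∈ [β+Δ, β+2Δ]`, to be 96 %-pure at the quadrupled scale `4L` — with
  `Δ`, `L₁`, `β₂` uniform in `β`.  Continuum-scaling covariance of purity, one cutoff-octave at a time.
* `CofinalExitAt (1/24)` (**K1**, verbatim the `ExitsUnboundedAt (1/24)` of line «coupling-clopen», shared): cofinally in
  `β`, ONE cold torus of side `≥ 8` is 96 %-pure.  THE NUMBER, asked only cofinally.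
* PROVED seams: `deep_of_le24` (exit `≤ 1/24` ⇒ defect `≤ 2⁻²⁵` at all large scales: landed basin `abstractBasin_24_epsStar`
  + landed decay `CouplingAxis.decay_of_exit`), `upward_of_scaling : OH → OH_E`, the window induction
  `coldExitAt_of_upward : OH_E → K1 → ColdExitAt (1/24)`, the exact re-cut `recut_iff : (OH_E ∧ K1) ↔ ColdExitAt (1/24)`
  (the critics' K-probe, delivered here: the scale-free shadow `OH_E` of OH is an exact re-cut of E; OH's surplus over it
  is the SCALE LAW `onset(β') ≤ 4·onset(β)`), and `IR_of : OH → K1 → X → N → IR` concluding the crux BY NAME.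
* sorries ONLY in the four registered `stub_*`.

**Rev 2 (2026-08-28T06:20Z, THIN):** the statements and sorry-free seams (§1–§3, `IR_of`, `IR_of_at`, `IR_of_sharp`) are LANDED in
`Theorems/BalabanLadderIRScalingHeredity.lean` (p607596, commit 611b032b9503; critics crit-1/crit-2 PASS-WITH-PRICE 05:35Z/05:32Z, g9-№2
lane; crit-1's sharpening adopted there: `ScalingHeredityAt η θ s` with the scale factor `s` a parameter, registered OH = `s = 4`).  This
workfile now only imports them and keeps the registered stubs + `IR_of_stubs`.  Sister line on the same axis: idea-10's `diagonal_heredity.lean`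
(independent, filed 05:23Z; see card rev 1.1).
-/

open Summit.QuantumFields.YangMills.Cruxes.IR.ColdPressurePincer
open Summit.QuantumFields.YangMills.Cruxes.IR.BasinRung

namespace Summit.QuantumFields.YangMills.Cruxes.IR.ScalingHeredity

/-! ## §4 Registered stubs (sorries ONLY here) — statements are the landed decls of `Theorems/BalabanLadderIRScalingHeredity.lean` -/

/-- **stub (LOAD, new): OH** — scaling heredity of purity along the RG diagonal (`ScalingHereditySC = ScalingHeredityAt 2⁻²⁵ (1/24) 4`). -/
theorem stub_scalingHeredity : ScalingHereditySC := by
  sorry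

/-- **stub (shared with «coupling-clopen» K1 at θ = 1/24): cofinal exits** — THE NUMBER, asked cofinally once per threshold. -/
theorem stub_cofinalExit : CofinalExitAt (1 / 24) := by
  sorry

/-- **stub (shared X): the asymptotic-freedom pin**, verbatim `ColdPressurePincer.AFToColdPressure`.  (LINE B `pinned_exit_96.lean` shows the
floor-unit node `PinnedExitAt (1/24)` through which an X-free bill runs, for mechanisms that pin their witness.) -/
theorem stub_afPin : AFToColdPressure := by
  sorry

/-- **stub (residual of record N): the crux on non-simply-connected groups**, verbatim `ColdPressurePincer.IRnsc`. -/
theorem stub_irnsc : IRnsc := by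
  sorry

/-! ## §5 Composition: the line concludes the crux BY NAME (landed `IR_of`) -/

/-- The crux over the registered stubs. -/
theorem IR_of_stubs : Summit.QuantumFields.YangMills.Theses.BalabanLadder.IR :=
  IR_of stub_scalingHeredity stub_cofinalExit stub_afPin stub_irnsc

/-- The same with OH at a general scale factor `s ≥ 1` (landed `IR_of_at`), for the record. -/
theorem IR_of_stubs_at {s : ℕ} (hs : 1 ≤ s) (hOH : ScalingHeredityAt (1 / 2 ^ 25) (1 / 24) s) :
    Summit.QuantumFields.YangMills.Theses.BalabanLadder.IR :=
  IR_of_at hs hOH stub_cofinalExit stub_afPin stub_irnsc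

end Summit.QuantumFields.YangMills.Cruxes.IR.ScalingHeredity
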